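import Literature.Algebra.EuclideanLattices.MRGapCVPVerifierAcceptance
import Literature.Algebra.EuclideanLattices.ARVerifierAlgebra
import HarnessLib

/-!
# MR07 Thm. 5.23 with an integer-arithmetic verifier: the distance-to-`ℤ` test replaces the cosine test — acceptance on NO instances, proved

Topic `Algebra/EuclideanLattices` (family `pqc`); serves the machine-level rendering of the named fact
`Literature.Computability.Cryptography.MicciancioRegev2007_gapCVP'_to_SIS'` (MR07 Thm. 5.23 proper,
`GapSVPToSIS.lean`). In the NO case of the reduction (authors' version pp. 29–31) the Aharonov–Regev
verifier is run on `N` independent witnesses `wᵢ ∈ L(B)*`; its test (b) `f_W(t) = N⁻¹∑ cos(2π⟨t, wᵢ⟩) < 1/2`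
involves cosines, which a Turing machine working on the (rational) witnesses cannot evaluate exactly. As in
the tree's integer rendering of the Aharonov–Regev verifier (`ARVerifier.lean`, test (a'')), the machine
tests instead the **distance-to-the-nearest-integer statistic**

  (b′) `θ_b · N ≤ ∑ᵢ ‖⟨t, wᵢ⟩‖²_{ℝ/ℤ}`  (`‖·‖_{ℝ/ℤ} = distInt`, exact rational arithmetic on the phases),

keeping test (c) in its quadratic-form reading `∑ᵢ ⟨x, wᵢ⟩² ≤ Θ‖x‖²` (decided on the machine by the trace
of a power of the integer moment matrix, `ARVerifierAlgebra.lean`). This file proves that (b′) ∧ (c) hold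
for independent witnesses satisfying MR07's per-sample bounds (16)–(18), except with exponentially small
probability — the NO-case analysis of the modified verifier:

* `lipschitzWith_distInt`, `continuous_distInt` — `‖·‖_{ℝ/ℤ}` is `1`-Lipschitz;
* `measureReal_sum_distInt_sq_le_le` — **test (b′)**: if `E cos(2π⟨t, wᵢ⟩) ≤ μ` (eq. (16)) for independent
  `wᵢ`, then `Pr[∑ᵢ ‖⟨t, wᵢ⟩‖² ≤ N((1 − μ)/(2π²) − δ)] ≤ e^{−32Nδ²}`: pointwise
  `‖y‖²_{ℝ/ℤ} ≥ (1 − cos 2πy)/(2π²)` (`one_sub_mul_distInt_sq_le_cos`), so `E‖⟨t, wᵢ⟩‖² ≥ (1 − μ)/(2π²)`,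
  and Hoeffding (MR07 eq. (14), tree: `measureReal_le_sum_le_exp_of_integral_le`) for summands in `[0, 1/4]`;
* `measureReal_verifierZ_reject_le` — union bound with Lemma 5.20 (test (c), tree:
  `measureReal_exists_lt_sum_inner_sq_le`): for `θ_b ≤ (1 − μ)/(2π²) − δ` and `Θ ≥ 3Nℓ²`,
  `Pr[¬((b′) ∧ (c))] ≤ e^{−32Nδ²} + e^{−N/K⁴}(4√n K²)ⁿ + Nσ`;
* `three_mul_sq_printed`, `measureReal_verifierZ_reject_le_mr` — the same with the printed parameters
  `γ = 14π√nβ`, `s = 2√n/(γd)`, `ℓ = 2sβ` (`3ℓ² = 12/(49π²d²)`), `μ = 2·2⁻ⁿ`.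

The YES case (soundness of (b′) ∧ (c): `∑ ‖⟨t, wᵢ⟩‖² ≤ ∑⟨e, wᵢ⟩² ≤ Θ d² < θ_b N`) and the idealised
reduction with this verifier are in `MRGapCVPIdealisedZ.lean`. Theorems only; no named facts.

## References

* D. Micciancio, O. Regev, *Worst-case to average-case reductions based on Gaussian measures*,
  SIAM J. Comput. 37 (2007) 267–302; authors' version (`lit read doi:10.1137/S0097539705447360`),
  proof of Thm. 5.23, pp. 29–31 (tests (b), (c); eq. (14), (16)–(18), Lemma 5.20).
* D. Aharonov, O. Regev, *Lattice problems in NP ∩ coNP*, J. ACM 52 (2005) 749–765, §6.1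
  (`cos 2πθ ≥ 1 − 2π²‖θ‖²`, the distance-to-`ℤ` form of the test).
* W. Hoeffding, *Probability inequalities for sums of bounded random variables*, JASA 58 (1963), Thm. 2.
-/

noncomputable section

open MeasureTheory ProbabilityTheory Module Finset Literature.NumberTheory.Sieve.Vinogradov
open scoped Real InnerProductSpace

namespace Literature.Algebra.EuclideanLattices

namespace MicciancioRegev2007

/-! ### `‖·‖_{ℝ/ℤ}` is Lipschitz -/

/-- The distance to the nearest integer is `1`-Lipschitz: `‖x‖ ≤ ‖y‖ + |x − y|`. [folklore] -/
theorem lipschitzWith_distInt : LipschitzWith 1 distInt := by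
  refine LipschitzWith.of_le_add fun x y => ?_
  have h1 := distInt_sub_distInt_le y x
  have h2 : distInt (y - x) ≤ |y - x| := distInt_le_abs _
  rw [Real.dist_eq, abs_sub_comm]
  linarith

/-- The distance to the nearest integer is continuous. [folklore] -/
theorem continuous_distInt : Continuous distInt := lipschitzWith_distInt.continuous

variable {V : Type*} [NormedAddCommGroup V] [InnerProductSpace ℝ V] [FiniteDimensional ℝ V]
  [MeasurableSpace V] [BorelSpace V]
variable {Ω : Type*} [MeasurableSpace Ω] {P : Measure Ω} [IsProbabilityMeasure P]
variable {ι : Type*} [Fintype ι]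

/-! ### Test (b′): the distance-to-`ℤ` statistic is large -/

omit [FiniteDimensional ℝ V] in
/-- **Test (b′) fails only with exponentially small probability.** If `w₁, …, w_N` are independent random
vectors with `E cos(2π⟨t, wᵢ⟩) ≤ μ` for every `i` (MR07 eq. (16)), then for every `δ ≥ 0`,
`Pr[∑ᵢ ‖⟨t, wᵢ⟩‖²_{ℝ/ℤ} ≤ N((1 − μ)/(2π²) − δ)] ≤ e^{−32Nδ²}`: by `cos 2πy ≥ 1 − 2π²‖y‖²` each summand has
mean `≥ (1 − μ)/(2π²)`, and the summands lie in `[0, 1/4]` (Hoeffding, eq. (14)).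
[cite: MicciancioRegev2007, Thm. 5.23 (proof, test (b) and eq. (14), (16), pp. 27–30) — distance-to-ℤ variant, AharonovRegev2005 §6.1] -/
theorem measureReal_sum_distInt_sq_le_le {w : ι → Ω → V} (hind : iIndepFun w P)
    (hmeas : ∀ i, AEMeasurable (w i) P) (t : V) {μ : ℝ}
    (hμ : ∀ i, ∫ ω, Real.cos (2 * π * ⟪t, w i ω⟫_ℝ) ∂P ≤ μ) {δ : ℝ} (hδ : 0 ≤ δ) :
    P.real {ω | ∑ i, distInt ⟪t, w i ω⟫_ℝ ^ 2 ≤ Fintype.card ι * ((1 - μ) / (2 * π ^ 2) - δ)} ≤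
      Real.exp (-(32 * Fintype.card ι * δ ^ 2)) := by
  classical
  set φ : V → ℝ := fun x => -(distInt ⟪t, x⟫_ℝ ^ 2) with hφ
  have hφm : Measurable φ :=
    ((continuous_distInt.comp (continuous_const.inner continuous_id)).pow 2).neg.measurable
  set ψ : V → ℝ := fun x => Real.cos (2 * π * ⟪t, x⟫_ℝ) with hψ
  have hψm : Measurable ψ :=
    (Real.continuous_cos.comp (continuous_const.mul (continuous_const.inner continuous_id))).measurable
  set X : ι → Ω → ℝ := fun i ω => φ (w i ω) with hX
  have hXind : iIndepFun X P := hind.comp (fun _ => φ) fun _ => hφm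
  have hXmeas : ∀ i, AEMeasurable (X i) P := fun i => hφm.comp_aemeasurable (hmeas i)
  have hXbd : ∀ i, ∀ᵐ ω ∂P, X i ω ∈ Set.Icc (-(1 / 4) : ℝ) 0 := fun i =>
    ae_of_all _ fun ω => by
      refine ⟨?_, ?_⟩
      · have h1 := distInt_le_half ⟪t, w i ω⟫_ℝ
        have h0 := distInt_nonneg ⟪t, w i ω⟫_ℝ
        change -(1 / 4 : ℝ) ≤ -(distInt ⟪t, w i ω⟫_ℝ ^ 2)
        nlinarith
      · change -(distInt ⟪t, w i ω⟫_ℝ ^ 2) ≤ 0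
        nlinarith [sq_nonneg (distInt ⟪t, w i ω⟫_ℝ)]
  -- the means: `E X_i ≤ -(1 - μ)/(2π²)`
  have hXint : ∀ i, Integrable (X i) P := fun i =>
    Integrable.of_bound (hXmeas i).aestronglyMeasurable (1 / 4) (ae_of_all _ fun ω => by
      have h1 := distInt_le_half ⟪t, w i ω⟫_ℝ
      have h0 := distInt_nonneg ⟪t, w i ω⟫_ℝ
      change |-(distInt ⟪t, w i ω⟫_ℝ ^ 2)| ≤ 1 / 4
      rw [abs_neg, abs_of_nonneg (sq_nonneg _)]
      nlinarith)
  have hCint : ∀ i, Integrable (fun ω => ψ (w i ω)) P := fun i =>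
    Integrable.of_bound ((hψm.comp_aemeasurable (hmeas i)).aestronglyMeasurable) 1
      (ae_of_all _ fun ω => by
        change |Real.cos (2 * π * ⟪t, w i ω⟫_ℝ)| ≤ 1
        exact Real.abs_cos_le_one _)
  have hμ' : ∀ i, ∫ ω, X i ω ∂P ≤ -((1 - μ) / (2 * π ^ 2)) := by
    intro i
    have hpt : ∀ ω, X i ω ≤ (ψ (w i ω) - 1) / (2 * π ^ 2) := fun ω => by
      have h := one_sub_mul_distInt_sq_le_cos ⟪t, w i ω⟫_ℝ
      change -(distInt ⟪t, w i ω⟫_ℝ ^ 2) ≤ (Real.cos (2 * π * ⟪t, w i ω⟫_ℝ) - 1) / (2 * π ^ 2)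
      rw [le_div_iff₀ (by positivity)]
      nlinarith
    have h1 : ∫ ω, X i ω ∂P ≤ ∫ ω, (ψ (w i ω) - 1) / (2 * π ^ 2) ∂P :=
      integral_mono (hXint i) (((hCint i).sub (integrable_const 1)).div_const _) hpt
    have h2 : ∫ ω, (ψ (w i ω) - 1) / (2 * π ^ 2) ∂P = (∫ ω, ψ (w i ω) ∂P - 1) / (2 * π ^ 2) := by
      rw [integral_div, integral_sub (hCint i) (integrable_const 1), integral_const, probReal_univ,
        one_smul]
    rw [h2] at h1
    have h3 : (∫ ω, ψ (w i ω) ∂P - 1) / (2 * π ^ 2) ≤ -((1 - μ) / (2 * π ^ 2)) := by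
      rw [div_le_iff₀ (by positivity)]
      have := hμ i
      have hrew : -((1 - μ) / (2 * π ^ 2)) * (2 * π ^ 2) = μ - 1 := by
        field_simp
        ring
      rw [hrew]
      change ∫ ω, Real.cos (2 * π * ⟪t, w i ω⟫_ℝ) ∂P - 1 ≤ μ - 1
      linarith
    exact h1.trans h3
  have hH := Literature.Probability.Moments.measureReal_le_sum_le_exp_of_integral_le hXind hXmeas hXbd hμ'
    hδ Finset.univ
  have hsub : {ω | ∑ i, distInt ⟪t, w i ω⟫_ℝ ^ 2 ≤ Fintype.card ι * ((1 - μ) / (2 * π ^ 2) - δ)} ⊆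
      {ω | ((Finset.univ : Finset ι).card : ℝ) * (-((1 - μ) / (2 * π ^ 2)) + δ) ≤
        ∑ i ∈ Finset.univ, X i ω} := by
    intro ω hω
    simp only [Set.mem_setOf_eq, Finset.card_univ] at hω ⊢
    have : ∑ i, X i ω = -∑ i, distInt ⟪t, w i ω⟫_ℝ ^ 2 := by
      rw [← Finset.sum_neg_distrib]
    rw [this]
    linarith
  refine (measureReal_mono hsub).trans (hH.trans (le_of_eq ?_))
  rw [Finset.card_univ]
  congr 1
  ring

/-! ### The modified verifier: (b′) ∧ (c) -/

/-- **The modified verifier accepts `N` independent good samples**: let `wᵢ : Ω → V` (`i ∈ ι`, `N = #ι`,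
`n = dim V`) be independent square-integrable random vectors with `E cos(2π⟨t, wᵢ⟩) ≤ μ` (eq. (16)),
`E⟨u, wᵢ⟩² ≤ ℓ²` for unit `u` (eq. (18)) and `Pr[‖wᵢ‖ ≥ Kℓ] ≤ σ` (eq. (17)); let `δ ≥ 0`,
`θ_b ≤ (1 − μ)/(2π²) − δ` and `Θ ≥ 3Nℓ²`. Then the probability that test (b′) `θ_b N ≤ ∑ᵢ ‖⟨t, wᵢ⟩‖²_{ℝ/ℤ}`
or test (c) `∀ x, ∑ᵢ ⟨x, wᵢ⟩² ≤ Θ‖x‖²` fails is at most `e^{−32Nδ²} + e^{−N/K⁴}(4√n K²)ⁿ + Nσ`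
(Hoeffding for (b′), Lemma 5.20 for (c), union bound).
[cite: MicciancioRegev2007, Thm. 5.23 (proof, pp. 29–31) — with the distance-to-ℤ test of AharonovRegev2005 §6.1 in place of (b)] -/
theorem measureReal_verifierZ_reject_le {w : ι → Ω → V} (hind : iIndepFun w P)
    (hL2 : ∀ i, MemLp (w i) 2 P) (t : V) {μ ℓ K σ δ θb Θ : ℝ}
    (hμ : ∀ i, ∫ ω, Real.cos (2 * π * ⟪t, w i ω⟫_ℝ) ∂P ≤ μ) (hδ : 0 ≤ δ)
    (hθb : θb ≤ (1 - μ) / (2 * π ^ 2) - δ) (hℓ : 0 < ℓ) (hK : 0 < K)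
    (h2 : ∀ i (u : V), ‖u‖ = 1 → ∫ ω, ⟪u, w i ω⟫_ℝ ^ 2 ∂P ≤ ℓ ^ 2)
    (htail : ∀ i, P.real {ω | K * ℓ ≤ ‖w i ω‖} ≤ σ) (hΘ : Fintype.card ι * (3 * ℓ ^ 2) ≤ Θ) :
    P.real {ω | ¬ (θb * Fintype.card ι ≤ ∑ i, distInt ⟪t, w i ω⟫_ℝ ^ 2 ∧
        ∀ x : V, ∑ i, ⟪x, w i ω⟫_ℝ ^ 2 ≤ Θ * ‖x‖ ^ 2)} ≤
      Real.exp (-(32 * Fintype.card ι * δ ^ 2)) +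
        (Real.exp (-(Fintype.card ι / K ^ 4)) * (4 * Real.sqrt (finrank ℝ V) * K ^ 2) ^ finrank ℝ V +
          Fintype.card ι * σ) := by
  set badB : Set Ω :=
    {ω | ∑ i, distInt ⟪t, w i ω⟫_ℝ ^ 2 ≤ Fintype.card ι * ((1 - μ) / (2 * π ^ 2) - δ)} with hbadB
  set badC : Set Ω :=
    {ω | ∃ u : V, 3 * Fintype.card ι * ℓ ^ 2 * ‖u‖ ^ 2 < ∑ i, ⟪u, w i ω⟫_ℝ ^ 2} with hbadC
  have hN : (0 : ℝ) ≤ Fintype.card ι := Nat.cast_nonneg _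
  have hsub : {ω | ¬ (θb * Fintype.card ι ≤ ∑ i, distInt ⟪t, w i ω⟫_ℝ ^ 2 ∧
      ∀ x : V, ∑ i, ⟪x, w i ω⟫_ℝ ^ 2 ≤ Θ * ‖x‖ ^ 2)} ⊆ badB ∪ badC := by
    intro ω hω
    simp only [Set.mem_setOf_eq, not_and_or, not_le, not_forall] at hω
    rcases hω with hb | ⟨x, hx⟩
    · refine Or.inl ?_
      change ∑ i, distInt ⟪t, w i ω⟫_ℝ ^ 2 ≤ Fintype.card ι * ((1 - μ) / (2 * π ^ 2) - δ)
      have : θb * Fintype.card ι ≤ Fintype.card ι * ((1 - μ) / (2 * π ^ 2) - δ) := by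
        rw [mul_comm]
        exact mul_le_mul_of_nonneg_left hθb hN
      linarith
    · refine Or.inr ⟨x, lt_of_le_of_lt ?_ hx⟩
      have hx2 : 0 ≤ ‖x‖ ^ 2 := sq_nonneg _
      calc 3 * (Fintype.card ι : ℝ) * ℓ ^ 2 * ‖x‖ ^ 2 = (Fintype.card ι * (3 * ℓ ^ 2)) * ‖x‖ ^ 2 := by
            ring
        _ ≤ Θ * ‖x‖ ^ 2 := mul_le_mul_of_nonneg_right hΘ hx2
  have hB : P.real badB ≤ Real.exp (-(32 * Fintype.card ι * δ ^ 2)) :=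
    measureReal_sum_distInt_sq_le_le hind (fun i => (hL2 i).1.aemeasurable) t hμ hδ
  have hC : P.real badC ≤
      Real.exp (-(Fintype.card ι / K ^ 4)) * (4 * Real.sqrt (finrank ℝ V) * K ^ 2) ^ finrank ℝ V +
        Fintype.card ι * σ :=
    Literature.Probability.Moments.MicciancioRegev2007.measureReal_exists_lt_sum_inner_sq_le hind hL2
      hℓ hK h2 htail
  calc P.real _ ≤ P.real (badB ∪ badC) := measureReal_mono hsub
    _ ≤ P.real badB + P.real badC := measureReal_union_le _ _
    _ ≤ _ := add_le_add hB hC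

/-- The printed threshold of test (c): with `γ = 14π√nβ`, `s = 2√n/(γd)` and `ℓ = 2sβ` (so `s = 1/(7πβd)`),
`3ℓ² = 12 s²β² = 12/(49π²d²)` (MR07 p. 30: "the probability that the largest eigenvalue of `W Wᵀ` is
bigger than `12 N s²β²`"). [cite: MicciancioRegev2007, Thm. 5.23 (proof, p. 30)] -/
theorem three_mul_sq_printed {n : ℕ} (hn : 1 ≤ n) {β d : ℝ} (hβ : 0 < β) (hd : 0 < d) :
    3 * (2 * (2 * Real.sqrt n / (14 * π * Real.sqrt n * β * d)) * β) ^ 2 = 12 / (49 * π ^ 2 * d ^ 2) := by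
  have hsq : 0 < Real.sqrt n := Real.sqrt_pos.2 (by exact_mod_cast hn)
  have hπ : 0 < π := Real.pi_pos
  field_simp
  ring

/-- **The modified verifier accepts, printed parameters** (pp. 29–31 with the distance-to-`ℤ` test): with
`n = dim V ≥ 1`, `β, d > 0`, `γ = 14π√nβ`, `s = 2√n/(γd)`, `ℓ = 2sβ` and `N` independent square-integrable
samples `wᵢ` satisfying eq. (16) `E cos(2π⟨t, wᵢ⟩) ≤ 2·2⁻ⁿ`, eq. (18) `E⟨u, wᵢ⟩² ≤ (2sβ)²` (unit `u`) and
eq. (17) `Pr[‖wᵢ‖ ≥ K·2sβ] ≤ σ`: for `δ ≥ 0`, `θ_b ≤ (1 − 2·2⁻ⁿ)/(2π²) − δ` and `Θ ≥ 12N/(49π²d²)`, the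
probability that (b′) `θ_b N ≤ ∑ᵢ ‖⟨t, wᵢ⟩‖²_{ℝ/ℤ}` or (c) `∑ᵢ ⟨x, wᵢ⟩² ≤ Θ‖x‖²` (all `x`) fails is at most
`e^{−32Nδ²} + e^{−N/K⁴}(4√n K²)ⁿ + Nσ`.
[cite: MicciancioRegev2007, Thm. 5.23 (proof, pp. 29–31) — with the distance-to-ℤ test of AharonovRegev2005 §6.1 in place of (b)] -/
theorem measureReal_verifierZ_reject_le_mr {w : ι → Ω → V} (hind : iIndepFun w P)
    (hL2 : ∀ i, MemLp (w i) 2 P) (t : V) {β d K σ δ θb Θ : ℝ} (hβ : 0 < β) (hd : 0 < d) (hK : 0 < K)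
    (hn : 1 ≤ finrank ℝ V)
    (h16 : ∀ i, ∫ ω, Real.cos (2 * π * ⟪t, w i ω⟫_ℝ) ∂P ≤ 2 * (2⁻¹ : ℝ) ^ finrank ℝ V)
    (h18 : ∀ i (u : V), ‖u‖ = 1 → ∫ ω, ⟪u, w i ω⟫_ℝ ^ 2 ∂P ≤
      (2 * (2 * Real.sqrt (finrank ℝ V) / (14 * π * Real.sqrt (finrank ℝ V) * β * d)) * β) ^ 2)
    (h17 : ∀ i, P.real {ω | K *
      (2 * (2 * Real.sqrt (finrank ℝ V) / (14 * π * Real.sqrt (finrank ℝ V) * β * d)) * β) ≤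
        ‖w i ω‖} ≤ σ)
    (hδ : 0 ≤ δ) (hθb : θb ≤ (1 - 2 * (2⁻¹ : ℝ) ^ finrank ℝ V) / (2 * π ^ 2) - δ)
    (hΘ : Fintype.card ι * (12 / (49 * π ^ 2 * d ^ 2)) ≤ Θ) :
    P.real {ω | ¬ (θb * Fintype.card ι ≤ ∑ i, distInt ⟪t, w i ω⟫_ℝ ^ 2 ∧
        ∀ x : V, ∑ i, ⟪x, w i ω⟫_ℝ ^ 2 ≤ Θ * ‖x‖ ^ 2)} ≤
      Real.exp (-(32 * Fintype.card ι * δ ^ 2)) +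
        (Real.exp (-(Fintype.card ι / K ^ 4)) * (4 * Real.sqrt (finrank ℝ V) * K ^ 2) ^ finrank ℝ V +
          Fintype.card ι * σ) := by
  set s : ℝ := 2 * Real.sqrt (finrank ℝ V) / (14 * π * Real.sqrt (finrank ℝ V) * β * d) with hs
  have hsq : 0 < Real.sqrt (finrank ℝ V) := Real.sqrt_pos.2 (by exact_mod_cast hn)
  have hspos : 0 < s := by rw [hs]; positivity
  have hℓ : 0 < 2 * s * β := by positivity
  have hΘ' : Fintype.card ι * (3 * (2 * s * β) ^ 2) ≤ Θ := by
    rw [hs, three_mul_sq_printed hn hβ hd]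
    exact hΘ
  exact measureReal_verifierZ_reject_le hind hL2 t h16 hδ hθb hℓ hK h18 h17 hΘ'

end MicciancioRegev2007

end Literature.Algebra.EuclideanLattices

end
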